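import Summits.QuantumFields.YangMills.Theorems.IR.BlockedActivityWStrongCouplingSUN
import Summits.Ventures.YMGap.Thresholds.OneLinkVarianceSD
import HarnessLib

/-!
# Crux `IR` (stmt-QuantumFields-19354), lane B «strong coupling AFTER BLOCKING»: the `SU(2)` and `SU(3)` rows on the single-link Kantorovich
# windows — class W at EVERY mesh, the COFINAL Uc-mixing meshes, and one certified digit

Helper module for item `stmt-QuantumFields-19354` (`--supports`; it closes nothing), lane `ym-19354-onsetsc-p2` (g5); rows of
`SUN.blockedActivityClassW_mesh_of_oneLinkKRModulus` (`Theorems/IR/BlockedActivityWStrongCouplingSUN`) at two PROVED one-link moduli of the venture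
`YMGap`.

`SU(2)` (Wilson coupling `β_W = 4β`, tree coupling `β_W/2`; quarter modulus `QuarterModulusOneThird.oneLinkKRModulusSU2_of_le_oneThird`, radius
`3β_W/2`, constant `1`, Dobrushin row sum `9β_W/2`):
* ★ `su2_blockedActivityClassW_mesh` — `0 ≤ β_W ≤ 1/3`, `9β_W/2 ≤ q`, `0 < q < 1`, `b, n ≥ 1`:
  `BlockedActivityClassW (fundamentalRep (Fin 2)) (β_W/2) b n (sunMeshRadius 2 (β_W/2) q b n)` (radius `exp(1179648√2 · β_W e^{24β_W} b⁴ q^{2nb}) − 1`);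
* ★ `su2_blockedActivityClassW_eventually` — for every `β₁ < 2/9`, radius `a > 0`, window `n ≥ 1`: ONE mesh threshold `b₀` with class W at
  radius `a` for ALL `b ≥ b₀` and ALL `0 ≤ β_W ≤ β₁`; `su2_univShellCond_eventually` ∕ ★ `su2_typShellCondUKPc_eventually` — the Uc-mixing meshes are
  COFINAL for `SU(2)` at EVERY `0 ≤ β_W < 2/9` (g3: `β_W ≤ 1/216`; sharp every-group door: `β_W < 1/18`; THE NUMBER §A door (2): `0.3609…`);
* `su2_sunMeshRadius_40_le`, ★ `su2_blockedActivityClassW_40_radiusKP` ∕ `su2_univShellCond_40` — CERTIFIED DIGIT: at `(b, n) = (40, 1)` and every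
  `0 ≤ β_W ≤ 1/9` the radius is `≤ 10⁻¹⁰ < a⋆ = radiusKP(1∕3552)`: the `SU(2)` Wilson kernels are in the class of record AT THE NUMBER `a⋆` at mesh
  `40`, window `1`, on `0 ≤ β_W ≤ 1/9` (g3: mesh `32` on `β_W ≤ 1/216`).

`SU(3)` ('t Hooft coupling `β`, tree coupling `3β`; Poincaré × Schwinger–Dyson modulus `OneLinkVarianceSD.su3_oneLinkKRModulus_pv_of_le` at radius
`3/20` with the rational certificate `q = 41/40`, `p = 16904/10000`, constant `2113/1000`; Dobrushin row sum `38.034·|β|`):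
* `su3_oneLinkKRModulus_threeTwentieths : OneLinkKRModulus 3 (3/20) (2113/1000)`;
* ★ `su3_blockedActivityClassW_mesh` — `|β| ≤ 1/40`, `18·(2113/1000)·|β| ≤ q`, `0 < q < 1`: class W at every mesh at `sunMeshRadius 3 (3β) q b n`;
* ★ `su3_blockedActivityClassW_eventually` ∕ `su3_univShellCond_eventually` ∕ ★ `su3_typShellCondUKPc_eventually` — ONE threshold for the whole closed
  window `|β| ≤ 1/40` (tree `|3β| ≤ 3/40`; g3: `216·3·|3β| ≤ 1`, i.e. tree `≤ 1/648`): the Uc-mixing meshes are COFINAL for `SU(3)` there.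

HONEST FRAMING: a strong-coupling (Dobrushin-uniqueness) calibration of the lane's currency of record; LATTICE statements for `SU(2)`, `SU(3)` on `ℤ⁴`,
nothing about weak coupling, the onset, a gap or Clay.  No `sorry`; axioms ⊆ {propext, Classical.choice, Quot.sound}; no instances, no notation.
Refs: Dobrushin 1970; Georgii 2011 Thm. 8.20; Shen–Zhu–Zhu CMP 400 (2023); Cao–Nissim–Sheffield 2025 (single-link windows).
-/

set_option autoImplicit false

noncomputable section

open MeasureTheory ProbabilityTheory
open Literature.MathematicalPhysics.QuantumFieldTheory hiding ZdEdge Site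
open Literature.MathematicalPhysics.QuantumLattice
open Literature.MathematicalPhysics.QuantumFieldTheory.Balaban1983to89.StrongCouplingDobrushinWindow (OneLinkKRModulus)
open Literature.Probability.LatticeModels
open Summit.QuantumFields.YangMills.Cruxes.IR.OnsetFormats (UnivShellCond)
open Summit.QuantumFields.YangMills.Cruxes.IR.OnsetFormatsUc (TypShellCondUKPc typShellCondUKPc_of_univShellCond)
open Summit.Ventures.YMGap.QuarterModulusOneThird (oneLinkKRModulusSU2_of_le_oneThird)
open Summit.Ventures.YMGap.OneLinkVarianceSD (su3_oneLinkKRModulus_pv_of_le)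

namespace Summit.QuantumFields.YangMills.Cruxes.IR.BlockedActivity

namespace SUN

/-! ## §1 `SU(2)` on the quarter-modulus window `0 ≤ β_W < 2/9` -/

section SU2

/-- `2 · (β_W/4) = β_W/2` (tree coupling of `SU(2)` at Wilson `β_W`). -/
private theorem two_mul_quarter (βW : ℝ) : ((2 : ℕ) : ℝ) * (βW / 4) = βW / 2 := by push_cast; ring

/-- ★ **STRONG COUPLING AFTER BLOCKING for `SU(2)` on the Kantorovich window — class W at EVERY mesh.**  For `0 ≤ β_W ≤ 1/3`, `9β_W/2 ≤ q`,
`0 < q < 1`, every mesh `b ≥ 1` and window `n ≥ 1`: `BlockedActivityClassW (fundamentalRep (Fin 2)) (β_W/2) b n (sunMeshRadius 2 (β_W/2) q b n)`. -/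
theorem su2_blockedActivityClassW_mesh {βW q : ℝ} (h0 : 0 ≤ βW) (h13 : βW ≤ 1 / 3) (hq0 : 0 < q) (hq1 : q < 1) (hβq : 9 * βW / 2 ≤ q)
    {b n : ℕ} (hb : 1 ≤ b) (hn : 1 ≤ n) :
    BlockedActivityClassW (fundamentalRep (Fin 2) : Matrix.specialUnitaryGroup (Fin 2) ℂ →* _) (βW / 2) b n (sunMeshRadius 2 (βW / 2) q b n) := by
  have hmod : OneLinkKRModulus 2 (3 * βW / 2) (4 * (1 / 4)) := oneLinkKRModulusSU2_of_le_oneThird h13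
  have hR : |βW / 4| * 6 ≤ 3 * βW / 2 := by rw [abs_of_nonneg (by linarith)]; linarith
  have hβq' : 18 * (4 * (1 / 4)) * |βW / 4| ≤ q := by rw [abs_of_nonneg (by linarith)]; linarith
  have h := blockedActivityClassW_mesh_of_oneLinkKRModulus (N := 2) (by norm_num) (by norm_num) hR hmod hq0 hq1 hβq' hb hn
  rw [two_mul_quarter] at h
  exact h

/-- ★ **Class W at every radius at ALL large meshes for `SU(2)`, ONE threshold for the closed sub-window `0 ≤ β_W ≤ β₁`** (`β₁ < 2/9`; rate
`q = max(9β₁/2, 1/2)`; `n ≥ 1` fixed). -/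
theorem su2_blockedActivityClassW_eventually {β₁ a : ℝ} (h29 : β₁ < 2 / 9) (ha : 0 < a) {n : ℕ} (hn : 1 ≤ n) :
    ∃ b₀ : ℕ, 1 ≤ b₀ ∧ ∀ b : ℕ, b₀ ≤ b → ∀ βW : ℝ, 0 ≤ βW → βW ≤ β₁ →
      BlockedActivityClassW (fundamentalRep (Fin 2) : Matrix.specialUnitaryGroup (Fin 2) ℂ →* _) (βW / 2) b n a := by
  have hmod : OneLinkKRModulus 2 (3 * β₁ / 2) (4 * (1 / 4)) := oneLinkKRModulusSU2_of_le_oneThird (by linarith)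
  obtain ⟨b₀, hb₀, h⟩ := blockedActivityClassW_eventually_of_oneLinkKRModulus (N := 2) (by norm_num) (q := max (9 * β₁ / 2) (1 / 2))
    (β₁ := β₁ / 4) (by norm_num) hmod (by linarith) (by
      have : 18 * (4 * (1 / 4 : ℝ)) * (β₁ / 4) = 9 * β₁ / 2 := by ring
      rw [this]; exact le_max_left _ _) (lt_max_of_lt_right (by norm_num)) (max_lt (by linarith) (by norm_num)) ha hn
  refine ⟨b₀, hb₀, fun b hb βW hβ0 hβ1 => ?_⟩
  have hβ : |βW / 4| ≤ β₁ / 4 := by rw [abs_of_nonneg (by linarith)]; linarith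
  have := h b hb (βW / 4) hβ
  rwa [two_mul_quarter] at this

/-- **The universal shell condition for `SU(2)` at ALL large meshes**, one threshold for `0 ≤ β_W ≤ β₁` (`β₁ < 2/9`), every `0 < ε ≤ 1`, `n ≥ 1`. -/
theorem su2_univShellCond_eventually {β₁ ε : ℝ} (h29 : β₁ < 2 / 9) (hε : 0 < ε) (hε1 : ε ≤ 1) {n : ℕ} (hn : 1 ≤ n) :
    ∃ b₀ : ℕ, 1 ≤ b₀ ∧ ∀ b : ℕ, b₀ ≤ b → ∀ βW : ℝ, 0 ≤ βW → βW ≤ β₁ →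
      UnivShellCond (fundamentalRep (Fin 2) : Matrix.specialUnitaryGroup (Fin 2) ℂ →* _) (βW / 2) b n ε := by
  obtain ⟨b₀, hb₀, h⟩ := su2_blockedActivityClassW_eventually h29 (radiusKP_pos hε) hn
  exact ⟨b₀, hb₀, fun b hb βW hβ0 hβ1 => univShellCond_of_blockedActivityW_sharp (h b hb βW hβ0 hβ1) hε1 le_rfl⟩

/-- ★ **The Uc-mixing meshes are COFINAL for `SU(2)` at EVERY `0 ≤ β_W < 2/9`**: format Uc `TypShellCondUKPc (fundamentalRep (Fin 2)) (β_W/2) b n ε δ`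
(every `δ`) at all large meshes, one threshold for `0 ≤ β_W ≤ β₁` (`β₁ < 2/9`). -/
theorem su2_typShellCondUKPc_eventually {β₁ ε : ℝ} (h29 : β₁ < 2 / 9) (hε : 0 < ε) (hε1 : ε ≤ 1) {n : ℕ} (hn : 1 ≤ n) :
    ∃ b₀ : ℕ, 1 ≤ b₀ ∧ ∀ b : ℕ, b₀ ≤ b → ∀ βW : ℝ, 0 ≤ βW → βW ≤ β₁ → ∀ δ : ℝ,
      TypShellCondUKPc (fundamentalRep (Fin 2) : Matrix.specialUnitaryGroup (Fin 2) ℂ →* _) (βW / 2) b n ε δ := by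
  obtain ⟨b₀, hb₀, h⟩ := su2_univShellCond_eventually h29 hε hε1 hn
  exact ⟨b₀, hb₀, fun b hb βW hβ0 hβ1 δ => typShellCondUKPc_of_univShellCond (h b hb βW hβ0 hβ1) δ⟩

/-- **CERTIFIED DIGIT**: at `(b, n) = (40, 1)`, `q = 1/2` and every `0 ≤ β_W ≤ 1/9` the `SU(2)` radius is `≤ 10⁻¹⁰`
(`147456·√2·16·(β_W/2)·e^{24β_W}·40⁴·2^{−80} ≤ 147456·(3/2)·16·(1/18)·e³·40⁴·2^{−80} < 5·10⁻¹¹`, `e^{t} − 1 ≤ 2t` for `|t| ≤ 1`). -/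
theorem su2_sunMeshRadius_40_le {βW : ℝ} (h0 : 0 ≤ βW) (h19 : βW ≤ 1 / 9) : sunMeshRadius 2 (βW / 2) (1 / 2) 40 1 ≤ (1 : ℝ) / 10 ^ 10 := by
  set t : ℝ := 147456 * Real.sqrt 2 * ((2 : ℕ) : ℝ) ^ 4 * |βW / 2| * Real.exp (24 * ((2 : ℕ) : ℝ) * |βW / 2|) * ((40 : ℕ) : ℝ) ^ 4 *
    (1 / 2 : ℝ) ^ (2 * 1 * 40) with ht
  have habs : |βW / 2| = βW / 2 := abs_of_nonneg (by linarith)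
  have hsqrt : Real.sqrt 2 ≤ 3 / 2 := (Real.sqrt_lt' (by norm_num)).2 (by norm_num) |>.le
  have he1 : Real.exp 1 ≤ 2.7182818286 := Real.exp_one_lt_d9.le
  have he : Real.exp (24 * ((2 : ℕ) : ℝ) * |βW / 2|) ≤ Real.exp 1 ^ 3 := by
    rw [← Real.exp_nat_mul]
    exact Real.exp_le_exp.2 (by rw [habs]; push_cast; linarith)
  have he3 : Real.exp 1 ^ 3 ≤ 2.7182818286 ^ 3 := by gcongr
  have ht0 : 0 ≤ t := by positivity
  have htb : t ≤ 1 / (2 * 10 ^ 10) := by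
    have hβ : |βW / 2| ≤ 1 / 18 := by rw [habs]; linarith
    have : t ≤ 147456 * (3 / 2) * ((2 : ℕ) : ℝ) ^ 4 * (1 / 18) * (2.7182818286 ^ 3) * ((40 : ℕ) : ℝ) ^ 4 * (1 / 2 : ℝ) ^ (2 * 1 * 40) := by
      rw [ht]; gcongr; exact he.trans he3
    refine this.trans ?_
    norm_num
  have habs1 : |t| ≤ 1 := by rw [abs_of_nonneg ht0]; linarith [htb]
  have hexp : |Real.exp t - 1| ≤ 2 * |t| := Real.abs_exp_sub_one_le habs1
  rw [abs_of_nonneg ht0] at hexp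
  have : sunMeshRadius 2 (βW / 2) (1 / 2) 40 1 = Real.exp t - 1 := rfl
  rw [this]
  calc Real.exp t - 1 ≤ |Real.exp t - 1| := le_abs_self _
    _ ≤ 2 * t := hexp
    _ ≤ 1 / 10 ^ 10 := by linarith [htb]

/-- ★ **`SU(2)` AT THE NUMBER `a⋆` AFTER BLOCKING, mesh `40`**: for every `0 ≤ β_W ≤ 1/9` the `SU(2)` Wilson kernels at Wilson coupling `β_W` are in the
class of record at mesh `40`, window `1`, radius `radiusKP (1∕3552)` (`a⋆ ∈ (2.81, 2.88)·10⁻⁹`). -/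
theorem su2_blockedActivityClassW_40_radiusKP {βW : ℝ} (h0 : 0 ≤ βW) (h19 : βW ≤ 1 / 9) :
    BlockedActivityClassW (fundamentalRep (Fin 2) : Matrix.specialUnitaryGroup (Fin 2) ℂ →* _) (βW / 2) 40 1 (radiusKP (1 / 3552)) := by
  refine blockedActivityClassW_mono (Matrix.specialUnitaryGroup (Fin 2) ℂ)
    (su2_blockedActivityClassW_mesh (q := 1 / 2) h0 (by linarith) (by norm_num) (by norm_num) (by linarith) (by norm_num) le_rfl) ?_
  refine (su2_sunMeshRadius_40_le h0 h19).trans ?_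
  have h := (radiusKP_bounds (ε := 1 / 3552) (by norm_num)).1
  exact le_trans (by norm_num) h.le

/-- … hence `UnivShellCond (fundamentalRep (Fin 2)) (β_W/2) 40 1 (1∕3552)` for every `0 ≤ β_W ≤ 1/9` (the bootstrap accuracy at mesh `40`). -/
theorem su2_univShellCond_40 {βW : ℝ} (h0 : 0 ≤ βW) (h19 : βW ≤ 1 / 9) :
    UnivShellCond (fundamentalRep (Fin 2) : Matrix.specialUnitaryGroup (Fin 2) ℂ →* _) (βW / 2) 40 1 (1 / 3552) :=
  univShellCond_of_blockedActivityW_sharp (su2_blockedActivityClassW_40_radiusKP h0 h19) (by norm_num) le_rfl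

end SU2

/-! ## §2 `SU(3)` on the Poincaré × Schwinger–Dyson modulus window `|β| ≤ 1/40` -/

section SU3

/-- **The `SU(3)` one-link modulus at radius `3/20` with constant `2113/1000`** (rational certificate `q = 41/40`, `p = 16904/10000` of
`OneLinkVarianceSD.su3_oneLinkKRModulus_pv_of_le`: `1 + 9R²/4 = q²`, `p²(1/2 − R) ≥ 1`, `(3R/2 + q)p = K`). -/
theorem su3_oneLinkKRModulus_threeTwentieths : OneLinkKRModulus 3 (3 / 20) (2113 / 1000) :=
  su3_oneLinkKRModulus_pv_of_le (q := 41 / 40) (p := 16904 / 10000)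
    (by norm_num) (by norm_num) (by norm_num) (by norm_num) (by norm_num) (by norm_num) (by norm_num)

/-- ★ **STRONG COUPLING AFTER BLOCKING for `SU(3)` — class W at EVERY mesh** on the window `|β| ≤ 1/40` ('t Hooft `β`, tree coupling `3β`):
for `18·(2113/1000)·|β| ≤ q`, `0 < q < 1`, `b, n ≥ 1`: `BlockedActivityClassW (fundamentalRep (Fin 3)) (3β) b n (sunMeshRadius 3 (3β) q b n)`. -/
theorem su3_blockedActivityClassW_mesh {β q : ℝ} (hβ : |β| ≤ 1 / 40) (hq0 : 0 < q) (hq1 : q < 1) (hβq : 18 * (2113 / 1000) * |β| ≤ q)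
    {b n : ℕ} (hb : 1 ≤ b) (hn : 1 ≤ n) :
    BlockedActivityClassW (fundamentalRep (Fin 3) : Matrix.specialUnitaryGroup (Fin 3) ℂ →* _) (((3 : ℕ) : ℝ) * β) b n
      (sunMeshRadius 3 (((3 : ℕ) : ℝ) * β) q b n) :=
  blockedActivityClassW_mesh_of_oneLinkKRModulus (N := 3) (by norm_num) (by norm_num) (by linarith) su3_oneLinkKRModulus_threeTwentieths
    hq0 hq1 hβq hb hn

/-- ★ **Class W at every radius at ALL large meshes for `SU(3)`, ONE threshold for the whole window `|β| ≤ 1/40`** (rate `q = 951/1000`: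
`18 · 2.113 / 40 = 0.95085`). -/
theorem su3_blockedActivityClassW_eventually {a : ℝ} (ha : 0 < a) {n : ℕ} (hn : 1 ≤ n) :
    ∃ b₀ : ℕ, 1 ≤ b₀ ∧ ∀ b : ℕ, b₀ ≤ b → ∀ β : ℝ, |β| ≤ 1 / 40 →
      BlockedActivityClassW (fundamentalRep (Fin 3) : Matrix.specialUnitaryGroup (Fin 3) ℂ →* _) (((3 : ℕ) : ℝ) * β) b n a :=
  blockedActivityClassW_eventually_of_oneLinkKRModulus (N := 3) (by norm_num) (q := 951 / 1000) (β₁ := 1 / 40) (by norm_num)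
    su3_oneLinkKRModulus_threeTwentieths (by norm_num) (by norm_num) (by norm_num) (by norm_num) ha hn

/-- **The universal shell condition for `SU(3)` at ALL large meshes**, one threshold for `|β| ≤ 1/40`, every `0 < ε ≤ 1`, `n ≥ 1`. -/
theorem su3_univShellCond_eventually {ε : ℝ} (hε : 0 < ε) (hε1 : ε ≤ 1) {n : ℕ} (hn : 1 ≤ n) :
    ∃ b₀ : ℕ, 1 ≤ b₀ ∧ ∀ b : ℕ, b₀ ≤ b → ∀ β : ℝ, |β| ≤ 1 / 40 →
      UnivShellCond (fundamentalRep (Fin 3) : Matrix.specialUnitaryGroup (Fin 3) ℂ →* _) (((3 : ℕ) : ℝ) * β) b n ε :=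
  univShellCond_eventually_of_oneLinkKRModulus (N := 3) (by norm_num) (q := 951 / 1000) (β₁ := 1 / 40) (by norm_num)
    su3_oneLinkKRModulus_threeTwentieths (by norm_num) (by norm_num) (by norm_num) (by norm_num) hε hε1 hn

/-- ★ **The Uc-mixing meshes are COFINAL for `SU(3)` on `|β| ≤ 1/40`** (tree `|3β| ≤ 3/40`): format Uc at all large meshes, one threshold. -/
theorem su3_typShellCondUKPc_eventually {ε : ℝ} (hε : 0 < ε) (hε1 : ε ≤ 1) {n : ℕ} (hn : 1 ≤ n) :
    ∃ b₀ : ℕ, 1 ≤ b₀ ∧ ∀ b : ℕ, b₀ ≤ b → ∀ β : ℝ, |β| ≤ 1 / 40 → ∀ δ : ℝ,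
      TypShellCondUKPc (fundamentalRep (Fin 3) : Matrix.specialUnitaryGroup (Fin 3) ℂ →* _) (((3 : ℕ) : ℝ) * β) b n ε δ :=
  typShellCondUKPc_eventually_of_oneLinkKRModulus (N := 3) (by norm_num) (q := 951 / 1000) (β₁ := 1 / 40) (by norm_num)
    su3_oneLinkKRModulus_threeTwentieths (by norm_num) (by norm_num) (by norm_num) (by norm_num) hε hε1 hn

end SU3

end SUN

end Summit.QuantumFields.YangMills.Cruxes.IR.BlockedActivity

end
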